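import Summits.AtomisticToContinuum.FouriersLaw.Theses.EmbeddedDrudeMourre
import Summits.AtomisticToContinuum.FouriersLaw.Theses.LatticeLandauDamping
import Summits.AtomisticToContinuum.FouriersLaw.Theorems.EmbeddedDrudeMourreGreenKuboContinuationOfFourierGreenKubo
import Summits.AtomisticToContinuum.FouriersLaw.Theorems.LatticeLandauDampingAbelGreenKuboOfWindow
import Summits.AtomisticToContinuum.FouriersLaw.Theorems.EmbeddedDrudeMourreAbelOfSpectralDensity
import HarnessLib

/-!
# `GreenKuboContinuation` (stmt-AtomisticToContinuum-12597) from the frequency-0 spectral trichotomy of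
# route `LatticeLandauDamping` (stmt-14011 / 14012 / 14014), and its place relative to stmt-14010

The crux `EmbeddedDrudeMourre.GreenKuboContinuation` (propagation of Abelian Green–Kubo witnesses of
`pinnedChain ω₂ lam β γ` from a corner `(0, T₀)` to every `T > 0`) is, modulo the route's own corner items,
the conjunct's ALL-`T` Abelian Green–Kubo content, which is VERBATIM the target
`LatticeLandauDamping.AbelGreenKubo` (stmt-14010) of the sibling route. This file records the three
certified comparisons as importable theorems (the crux workfile
`Cruxes/GreenKuboContinuation/Lines/SpectralTrichotomy.lean` carries the same composition, but a workfile is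
not importable):

* `greenKuboContinuation_of_abelGreenKubo` — **stmt-12597 ≤ stmt-14010**: `AbelGreenKubo → GreenKuboContinuation`
  (the corner hypothesis is discarded; `greenKuboContinuation_of_abelWitnessAllT`, p115442);
* `abelGreenKubo_of_greenKuboContinuation` — **stmt-14010 ≤ stmt-12597 modulo the corner**:
  `DrudeDissolution → AbelOfSpectralDensity → GreenKuboContinuation → AbelGreenKubo`
  (`abelWitnessAllT_of_greenKuboContinuation`, p115442; `AbelOfSpectralDensity` is proved, stmt-12598);
* `greenKuboContinuation_of_spectralTrichotomy` — **the split glue**: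
  `WindowDecomposition → NoDrudeWeight → PositiveDensity → GreenKuboContinuation`, from the landed glue
  `abelGreenKuboOfWindow_proof` (stmt-14174, p87901) fed with the PROVED Poisson-kernel lemma
  `latticeLandauDamping_abelOfSpectralDensity_proof` (stmt-12598). This is the crux-strategist's prepared
  glue `GreenKuboContinuation_of_subs` (item evidence #103, `children.json`) for the A7 split of the crux
  along the trichotomy; a prover closes the generated glue item with `exact` this theorem.

All three are conditional on named route statements (items), hence recorded by the gate as conditional
results; none closes stmt-12597 by itself — they certify in the tree that the item is blocked exactly on
stmt-14011 / 14012 / 14014 (equivalently on stmt-14010, or on stmt-0703 via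
`greenKuboContinuation_of_fourierGreenKubo`).
-/

namespace Summit.AtomisticToContinuum.FouriersLaw.Theorems.GreenKuboContinuation

/-- **stmt-12597 ≤ stmt-14010.** The all-`T` Abelian Green–Kubo target of route `LatticeLandauDamping`
(`AbelGreenKubo`, stmt-14010 — verbatim the witness clause of the crux at every `T > 0`) implies
`EmbeddedDrudeMourre.GreenKuboContinuation`: the corner hypothesis is simply not used. [folklore] -/
theorem greenKuboContinuation_of_abelGreenKubo
    (h : Summit.AtomisticToContinuum.FouriersLaw.Theses.LatticeLandauDamping.AbelGreenKubo) :
    Summit.AtomisticToContinuum.FouriersLaw.Theses.EmbeddedDrudeMourre.GreenKuboContinuation :=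
  greenKuboContinuation_of_abelWitnessAllT h

/-- **stmt-14010 ≤ stmt-12597 modulo the corner.** Given the route's own corner export `DrudeDissolution`
(stmt-12593) and the proved Poisson-kernel lemma `AbelOfSpectralDensity` (stmt-12598), the crux
`GreenKuboContinuation` yields `LatticeLandauDamping.AbelGreenKubo` (all-`T` Abelian Green–Kubo): the
corner supplies witnesses on `(0, T₀)`, the crux propagates them. Together with
`greenKuboContinuation_of_abelGreenKubo`: modulo the corner the two items are equivalent. [folklore] -/
theorem abelGreenKubo_of_greenKuboContinuation
    (hDD : Summit.AtomisticToContinuum.FouriersLaw.Theses.EmbeddedDrudeMourre.DrudeDissolution)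
    (hA : Summit.AtomisticToContinuum.FouriersLaw.Theses.EmbeddedDrudeMourre.AbelOfSpectralDensity)
    (hC : Summit.AtomisticToContinuum.FouriersLaw.Theses.EmbeddedDrudeMourre.GreenKuboContinuation) :
    Summit.AtomisticToContinuum.FouriersLaw.Theses.LatticeLandauDamping.AbelGreenKubo :=
  abelWitnessAllT_of_greenKuboContinuation hDD hA hC

/-- **The corner items being what they are, unconditionally in `AbelOfSpectralDensity`:** the proved
Poisson-kernel lemma discharges the second hypothesis of `abelGreenKubo_of_greenKuboContinuation`, so
`DrudeDissolution → GreenKuboContinuation → AbelGreenKubo`. [folklore] -/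
theorem abelGreenKubo_of_drudeDissolution_of_greenKuboContinuation
    (hDD : Summit.AtomisticToContinuum.FouriersLaw.Theses.EmbeddedDrudeMourre.DrudeDissolution)
    (hC : Summit.AtomisticToContinuum.FouriersLaw.Theses.EmbeddedDrudeMourre.GreenKuboContinuation) :
    Summit.AtomisticToContinuum.FouriersLaw.Theses.LatticeLandauDamping.AbelGreenKubo :=
  abelGreenKubo_of_greenKuboContinuation hDD
    Summit.AtomisticToContinuum.FouriersLaw.Theorems.AbelOfSpectralDensity.abelOfSpectralDensity_proof hC

/-- **The split glue (frequency-0 spectral trichotomy ⇒ the crux).** The three spectral cruxes of route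
`LatticeLandauDamping` — `WindowDecomposition` (stmt-14011: a shift-invariant Gibbs state, a preserving
dynamics with absolutely convergent current correlations, a finite spectral measure `σ_T` of `C_T` and a
window on which `σ_T = σ_T{0}·δ₀ + g dω`, `g` continuous `≥ 0`), `NoDrudeWeight` (stmt-14012: `σ{0} = 0` for
every admissible representation) and `PositiveDensity` (stmt-14014: `0 < g 0` on any atom-free window) —
imply `EmbeddedDrudeMourre.GreenKuboContinuation`: by the landed glue `abelGreenKuboOfWindow_proof`
(stmt-14174) and the proved Poisson-kernel lemma (stmt-12598) they give `AbelGreenKubo` with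
`κ = π T⁻² g(0)`, and `greenKuboContinuation_of_abelGreenKubo` discards the corner. This is the glue of
the prepared A7 split of stmt-12597 into stmt-14011 / 14012 / 14014 (crux-strategist, item evidence #103
`GreenKuboContinuation_of_subs`, `children.json`). [folklore] -/
theorem greenKuboContinuation_of_spectralTrichotomy
    (h1 : Summit.AtomisticToContinuum.FouriersLaw.Theses.LatticeLandauDamping.WindowDecomposition)
    (h2 : Summit.AtomisticToContinuum.FouriersLaw.Theses.LatticeLandauDamping.NoDrudeWeight)
    (h3 : Summit.AtomisticToContinuum.FouriersLaw.Theses.LatticeLandauDamping.PositiveDensity) :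
    Summit.AtomisticToContinuum.FouriersLaw.Theses.EmbeddedDrudeMourre.GreenKuboContinuation :=
  greenKuboContinuation_of_abelGreenKubo
    (Summit.AtomisticToContinuum.FouriersLaw.Theorems.abelGreenKuboOfWindow_proof h1 h2 h3
      Summit.AtomisticToContinuum.FouriersLaw.Theorems.AbelOfSpectralDensity.latticeLandauDamping_abelOfSpectralDensity_proof)

end Summit.AtomisticToContinuum.FouriersLaw.Theorems.GreenKuboContinuation
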